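import Summits.FinalStateConjecture.FinalStateConjecture.Theorems.EIHFluxBalanceInertialRecessionLorentz
import Literature.Geometry.Lorentzian.KerrSchildEnergyCurrent
import Literature.Geometry.Lorentzian.KerrSchildWaveCauchyProblem
import Literature.Geometry.Lorentzian.KerrSchildEnergyEstimate
import Literature.Geometry.Lorentzian.KerrPriceLaw

/-!
# Route ClusterCompleteness — crux `AdiabaticMultiKerrILED`, line `Sketch`: finite-time energy growth,
# auxiliary lemmas

Helper file for the crux `stmt-FinalStateConjecture-14310`
(`Summit.FinalStateConjecture.FinalStateConjecture.Theses.ClusterCompleteness.AdiabaticMultiKerrILED`),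
supporting the lead's assembly `stub_finiteTimeEnergy_of` of line `Sketch`
(`Theorems/ClusterCompletenessAdiabaticMultiKerrILEDFiniteTimeEnergy.lean`): the pointwise
coercivity/boundedness of the lab `dt`-current at a point of normalised Kerr–Schild form (via the
constant background of the point), regularity of the current for general coefficients, the bound on
the rest-frame time of a boosted hole over a slab ball, closedness of the slab/truncation sets, the
exhaustion of the strict exterior by truncated sets, and two scalar inequalities. [folklore]
-/

noncomputable section

-- the doubled `FinalStateConjecture.FinalStateConjecture` path component trips dupNamespace
set_option linter.dupNamespace false

open scoped ContDiff Topology BigOperators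
open Metric Set Filter Literature.Geometry.Lorentzian

namespace Summit.FinalStateConjecture.FinalStateConjecture.Cruxes.AdiabaticMultiKerrILED.Sketch

/-! ### Pointwise facts at a point of normalised Kerr–Schild form (constant background) -/

/-- At a point where `G = η − φ₀ l₀ ⊗ l₀` with `0 ≤ φ₀ ≤ Φ`, `l₀` null and normalised, the lab
`dt`-current density is nonnegative, coercive (`∑(∂w)² ≤ 6 T^{00}`) and bounded
(`T^{00} ≤ 3(1+Φ)² ∑(∂w)²`): the pointwise lemmas of `KerrSchild.Background` at the constant
background of the point (the current at `x` sees only `G(x)`). [folklore] -/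
theorem fte_pointwise {G : E4 → Fin 4 → Fin 4 → ℝ} (w : E4 → ℝ) {x : E4}
    {Φ φ₀ : ℝ} {l₀ : E4} (hφ0 : 0 ≤ φ₀) (hφΦ : φ₀ ≤ Φ) (hnull : Minkowski.bilin l₀ l₀ = 0)
    (hnorm : Minkowski.bilin l₀ (E4.basisVector 0) = 1)
    (hG : ∀ μ ν, G x μ ν = Kerr.etaComp μ ν - φ₀ * l₀ μ * l₀ ν) :
    0 ≤ KerrSchild.normalCurrent G w x 0 ∧
      ∑ μ, fderiv ℝ w x (E4.basisVector μ) ^ 2 ≤ 6 * KerrSchild.normalCurrent G w x 0 ∧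
      KerrSchild.normalCurrent G w x 0 ≤ 3 * (1 + Φ) ^ 2 * ∑ μ, fderiv ℝ w x (E4.basisVector μ) ^ 2 := by
  let B₀ : KerrSchild.Background :=
    { φ := fun _ ↦ φ₀, l := fun _ ↦ l₀, bound := Φ, φ_nonneg := fun _ ↦ hφ0,
      φ_le := fun _ ↦ hφΦ, null := fun _ _ ↦ hnull, normalised := fun _ _ ↦ hnorm,
      contDiff_inverseMetric := fun μ ν ↦ by
        simp only [KerrSchild.inverseMetric]
        exact contDiff_const }
  have hGx : G x = B₀.inverseMetric x := by
    funext μ ν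
    rw [hG]
    rfl
  have hP : ∀ μ, KerrSchild.normalCurrent G w x μ = KerrSchild.normalCurrent B₀.inverseMetric w x μ := by
    intro μ
    simp only [KerrSchild.normalCurrent, hGx]
  refine ⟨?_, ?_, ?_⟩
  · rw [hP]; exact B₀.normalCurrent_zero_nonneg w x
  · rw [hP]; exact B₀.sum_sq_le_six_mul_normalCurrent_zero w x
  · rw [hP]; exact B₀.normalCurrent_zero_le w x

/-- The lab `dt`-current of a `C²` function is `C¹` at a point where the coefficients are `C¹`
(general-coefficient form of `KerrSchild.Background.contDiffAt_normalCurrent`). [folklore] -/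
theorem fte_contDiffAt_normalCurrent {G : E4 → Fin 4 → Fin 4 → ℝ} {w : E4 → ℝ}
    {x : E4} (hG : ∀ μ ν, ContDiffAt ℝ 1 (fun y ↦ G y μ ν) x) (hw : ContDiffAt ℝ 2 w x) (μ : Fin 4) :
    ContDiffAt ℝ 1 (fun y ↦ KerrSchild.normalCurrent G w y μ) x := by
  have h2 : ContDiffAt ℝ ((1 : ℕ∞) + 1 : ℕ∞) w x := by exact_mod_cast hw
  have hp : ∀ ν, ContDiffAt ℝ 1 (fun y ↦ fderiv ℝ w y (E4.basisVector ν)) x := fun ν ↦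
    (h2.fderiv_right (m := 1) le_rfl).clm_apply contDiffAt_const
  unfold KerrSchild.normalCurrent
  exact ((ContDiffAt.sum fun ν _ ↦ (hG μ ν).mul (hp ν)).mul
    (ContDiffAt.sum fun α _ ↦ (hG 0 α).mul (hp α))).sub
    ((contDiffAt_const.mul (hG 0 μ)).mul
      (ContDiffAt.sum fun α _ ↦ ContDiffAt.sum fun β _ ↦ ((hG α β).mul (hp α)).mul (hp β)))

/-! ### Special-relativity bookkeeping -/

/-- `|v⁰| ≤ ‖v‖` on `E4`. [folklore] -/
private theorem fte_abs_apply_zero_le_norm (v : E4) : |v 0| ≤ ‖v‖ := by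
  have h := Theorems.norm_sq_eq_sq_add_spatialNorm_sq v
  have h2 : v 0 ^ 2 ≤ ‖v‖ ^ 2 := by nlinarith [sq_nonneg (E4.spatialNorm v)]
  exact abs_le_of_sq_le_sq' h2 (norm_nonneg _) |> fun h ↦ abs_le.mpr h

/-- `‖x‖ ≤ |x⁰| + ‖x⃗‖` on `E4`. [folklore] -/
private theorem fte_norm_le (x : E4) : ‖x‖ ≤ |x 0| + E4.spatialNorm x := by
  have h := Theorems.norm_sq_eq_sq_add_spatialNorm_sq x
  have h0 : 0 ≤ E4.spatialNorm x := norm_nonneg _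
  have h1 : ‖x‖ ^ 2 ≤ (|x 0| + E4.spatialNorm x) ^ 2 := by
    rw [h, add_sq, sq_abs]
    nlinarith [abs_nonneg (x 0)]
  exact (abs_le_of_sq_le_sq' h1 (by positivity)).2

/-- **The rest-frame time on a slab ball is bounded**: `|(qx)⁰| ≤ ‖Λ⁻¹‖ (|x⁰| + ‖x⃗‖ + ‖p‖)` for
`q = poincareInv Λ (0, p)`. [folklore] -/
theorem fte_abs_restTime_le (Λ : lorentzGroup) (p : E3) (x : E4) :
    |(poincareInv Λ (E4.ofTimeSpace 0 p) x) 0| ≤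
      ‖((Λ : E4 ≃L[ℝ] E4).symm : E4 →L[ℝ] E4)‖ * (|x 0| + E4.spatialNorm x + ‖p‖) := by
  rw [poincareInv]
  have h1 := fte_abs_apply_zero_le_norm ((Λ : E4 ≃L[ℝ] E4).symm (x - E4.ofTimeSpace 0 p))
  have h2 : ‖(Λ : E4 ≃L[ℝ] E4).symm (x - E4.ofTimeSpace 0 p)‖ ≤
      ‖((Λ : E4 ≃L[ℝ] E4).symm : E4 →L[ℝ] E4)‖ * ‖x - E4.ofTimeSpace 0 p‖ :=
    ((Λ : E4 ≃L[ℝ] E4).symm : E4 →L[ℝ] E4).le_opNorm _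
  have h3 : ‖x - E4.ofTimeSpace 0 p‖ ≤ |x 0| + E4.spatialNorm x + ‖p‖ := by
    have hp : ‖E4.ofTimeSpace 0 p‖ = ‖p‖ := by
      rw [Theorems.norm_eq_spatialNorm_of_apply_zero_eq_zero (E4.ofTimeSpace_apply_zero 0 p),
        E4.spatialNorm_ofTimeSpace]
    calc ‖x - E4.ofTimeSpace 0 p‖ ≤ ‖x‖ + ‖E4.ofTimeSpace 0 p‖ := norm_sub_le _ _
      _ ≤ (|x 0| + E4.spatialNorm x) + ‖p‖ := add_le_add (fte_norm_le x) hp.le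
  calc _ ≤ _ := h1
    _ ≤ _ := h2
    _ ≤ _ := mul_le_mul_of_nonneg_left h3 (norm_nonneg _)

/-- **Exponential comparison on a slab ball**: for `0 ≤ x⁰ ≤ t`, `‖x⃗‖ ≤ ρ` and `M > 0`,
`e^{−B/(2M)} ≤ e^{−(qx)⁰/(2M)}` with `B = ‖Λ⁻¹‖ (t + ρ + ‖p‖)`. [folklore] -/
theorem fte_exp_restTime_le (Λ : lorentzGroup) (p : E3) {M : ℝ} (hM : 0 < M) {t ρ : ℝ} {x : E4}
    (hx0 : 0 ≤ x 0) (hxt : x 0 ≤ t) (hxρ : E4.spatialNorm x ≤ ρ) :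
    Real.exp (-((2 * M)⁻¹ * (‖((Λ : E4 ≃L[ℝ] E4).symm : E4 →L[ℝ] E4)‖ * (t + ρ + ‖p‖)))) ≤
      Real.exp (-((2 * M)⁻¹ * (poincareInv Λ (E4.ofTimeSpace 0 p) x) 0)) := by
  apply Real.exp_le_exp.mpr
  have hb := fte_abs_restTime_le Λ p x
  have hMi : 0 < (2 * M)⁻¹ := by positivity
  have h1 : |x 0| + E4.spatialNorm x + ‖p‖ ≤ t + ρ + ‖p‖ := by rw [abs_of_nonneg hx0]; linarith
  have h2 : (poincareInv Λ (E4.ofTimeSpace 0 p) x) 0 ≤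
      ‖((Λ : E4 ≃L[ℝ] E4).symm : E4 →L[ℝ] E4)‖ * (t + ρ + ‖p‖) :=
    ((le_abs_self _).trans hb).trans (mul_le_mul_of_nonneg_left h1 (norm_nonneg _))
  nlinarith

/-- Scalar bookkeeping of the layers: `0 < e_B ≤ e_z`, `0 ≤ d`, `d e_z ≤ θ e_B` force `d ≤ θ`.
[folklore] -/
theorem fte_le_of_mul_exp_le {d θ eB ez : ℝ} (heB : 0 < eB) (hBz : eB ≤ ez) (hd : 0 ≤ d)
    (h : d * ez ≤ θ * eB) : d ≤ θ := by
  by_contra hcon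
  rw [not_le] at hcon
  have h1 : θ * eB < d * eB := mul_lt_mul_of_pos_right hcon heB
  have h2 : d * eB ≤ d * ez := mul_le_mul_of_nonneg_left hBz hd
  linarith

/-- The slab set `{−2 ≤ x⁰ ≤ A} ∩ {‖x⃗‖ ≤ ρ} ∩ ⋂ᵢ {εᵢ ≤ hᵢ}` is closed for continuous `hᵢ`.
[folklore] -/
theorem fte_isClosed_slabSet {ι : Type*} {h : ι → E4 → ℝ} (hh : ∀ i, Continuous (h i))
    (ε : ι → ℝ) (A ρ : ℝ) :
    IsClosed {x : E4 | -2 ≤ x 0 ∧ x 0 ≤ A ∧ E4.spatialNorm x ≤ ρ ∧ ∀ i, ε i ≤ h i x} := by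
  have h0c : Continuous fun x : E4 ↦ x 0 := (contDiff_apply_zero (n := 0)).continuous
  have h1 : IsClosed {x : E4 | -2 ≤ x 0} := isClosed_le continuous_const h0c
  have h2 : IsClosed {x : E4 | x 0 ≤ A} := isClosed_le h0c continuous_const
  have h3 : IsClosed {x : E4 | E4.spatialNorm x ≤ ρ} :=
    isClosed_le E4.continuous_spatialNorm continuous_const
  have h4 : IsClosed {x : E4 | ∀ i, ε i ≤ h i x} := by
    rw [Set.setOf_forall]
    exact isClosed_iInter fun i ↦ isClosed_le continuous_const (hh i)
  have hK' : {x : E4 | -2 ≤ x 0 ∧ x 0 ≤ A ∧ E4.spatialNorm x ≤ ρ ∧ ∀ i, ε i ≤ h i x} =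
      (({x : E4 | -2 ≤ x 0} ∩ {x | x 0 ≤ A}) ∩ {x | E4.spatialNorm x ≤ ρ}) ∩
        {x | ∀ i, ε i ≤ h i x} := by
    ext x; simp only [Set.mem_setOf_eq, Set.mem_inter_iff, and_assoc]
  rw [hK']
  exact ((h1.inter h2).inter h3).inter h4

/-- The truncation set `{‖y‖ ≤ R} ∩ ⋂ᵢ {cᵢ ≤ rᵢ}` is closed for continuous `rᵢ`. [folklore] -/
theorem fte_isClosed_truncSet {ι : Type*} {r : ι → E3 → ℝ} (hr : ∀ i, Continuous (r i))
    (c : ι → ℝ) (R : ℝ) :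
    IsClosed {y : E3 | ‖y‖ ≤ R ∧ ∀ i, c i ≤ r i y} := by
  have h1 : IsClosed {y : E3 | ‖y‖ ≤ R} := isClosed_le continuous_norm continuous_const
  have h2 : IsClosed {y : E3 | ∀ i, c i ≤ r i y} := by
    rw [Set.setOf_forall]
    exact isClosed_iInter fun i ↦ isClosed_le continuous_const (hr i)
  have hS' : {y : E3 | ‖y‖ ≤ R ∧ ∀ i, c i ≤ r i y} = {y : E3 | ‖y‖ ≤ R} ∩ {y | ∀ i, c i ≤ r i y} := by
    ext y; simp only [Set.mem_setOf_eq, Set.mem_inter_iff]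
  rw [hS']
  exact h1.inter h2

/-- A positive margin below `6 Mᵢ` for every hole (`θ₀ = 1/(1 + ∑ᵢ Mᵢ⁻¹) ≤ Mᵢ`). [folklore] -/
theorem fte_exists_margin {N : ℕ} {M : Fin N → ℝ} (hM : ∀ i, 0 < M i) :
    ∃ θ₀ : ℝ, 0 < θ₀ ∧ ∀ i, θ₀ ≤ 6 * M i := by
  have hS0 : 0 ≤ ∑ j, (M j)⁻¹ := Finset.sum_nonneg fun j _ ↦ (inv_pos.mpr (hM j)).le
  refine ⟨1 / (1 + ∑ i, (M i)⁻¹), by positivity, fun i ↦ ?_⟩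
  have hsum : (M i)⁻¹ ≤ 1 + ∑ j, (M j)⁻¹ := by
    have := Finset.single_le_sum (f := fun j ↦ (M j)⁻¹) (fun j _ ↦ (inv_pos.mpr (hM j)).le)
      (Finset.mem_univ i)
    linarith
  have hMi := hM i
  calc 1 / (1 + ∑ j, (M j)⁻¹) ≤ 1 / (M i)⁻¹ := one_div_le_one_div_of_le (inv_pos.mpr hMi) hsum
    _ = M i := by rw [one_div, inv_inv]
    _ ≤ 6 * M i := by linarith

/-- **Exhaustion of the strict region by truncated sets**: for finitely many continuous `rᵢ` and
`θ₀ > 0`, `{∀ i, cᵢ < rᵢ} = ⋃ₙ {‖y‖ ≤ n + 1 ∧ ∀ i, cᵢ + θ₀/(n+1) ≤ rᵢ}`, an increasing union.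
[folklore] -/
theorem fte_iUnion_truncSet {ι : Type*} [Finite ι] (r : ι → E3 → ℝ) (c : ι → ℝ) {θ₀ : ℝ}
    (hθ₀ : 0 < θ₀) :
    Monotone (fun n : ℕ ↦ {y : E3 | ‖y‖ ≤ (n : ℝ) + 1 ∧ ∀ i, c i + θ₀ / ((n : ℝ) + 1) ≤ r i y}) ∧
    {y : E3 | ∀ i, c i < r i y} =
      ⋃ n : ℕ, {y : E3 | ‖y‖ ≤ (n : ℝ) + 1 ∧ ∀ i, c i + θ₀ / ((n : ℝ) + 1) ≤ r i y} := by
  constructor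
  · intro m n hmn y hy
    have hmn' : (m : ℝ) + 1 ≤ (n : ℝ) + 1 := by
      have : (m : ℝ) ≤ n := by exact_mod_cast hmn
      linarith
    refine ⟨hy.1.trans hmn', fun i ↦ ?_⟩
    have : θ₀ / ((n : ℝ) + 1) ≤ θ₀ / ((m : ℝ) + 1) :=
      div_le_div_of_nonneg_left hθ₀.le (by positivity) hmn'
    linarith [hy.2 i]
  · ext y
    simp only [Set.mem_setOf_eq, Set.mem_iUnion]
    constructor
    · intro hy
      have h1 : ∀ᶠ n : ℕ in atTop, ‖y‖ ≤ (n : ℝ) + 1 := by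
        obtain ⟨n, hn⟩ := exists_nat_ge ‖y‖
        refine eventually_atTop.mpr ⟨n, fun m hm ↦ hn.trans ?_⟩
        have : (n : ℝ) ≤ m := by exact_mod_cast hm
        linarith
      have h2 : ∀ i, ∀ᶠ n : ℕ in atTop, c i + θ₀ / ((n : ℝ) + 1) ≤ r i y := by
        intro i
        have hgap : 0 < r i y - c i := sub_pos.mpr (hy i)
        have hlim : Tendsto (fun n : ℕ ↦ θ₀ / ((n : ℝ) + 1)) atTop (𝓝 0) := by
          have := (tendsto_one_div_add_atTop_nhds_zero_nat).const_mul θ₀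
          rw [mul_zero] at this
          refine this.congr fun n ↦ ?_
          rw [mul_one_div]
        have hev := hlim.eventually (gt_mem_nhds hgap)
        exact hev.mono fun n hn ↦ by linarith
      obtain ⟨n, hn1, hn2⟩ := (h1.and (eventually_all.mpr h2)).exists
      exact ⟨n, hn1, hn2⟩
    · rintro ⟨n, -, hn⟩ i
      have : 0 < θ₀ / ((n : ℝ) + 1) := by positivity
      linarith [hn i]

/-- The constant of the finite-time estimate dominates: `18(1+Φ)² e^{Ct} ≤ K e^{Kt}` with
`C = 192(1+Φ)D`, `K = 18(1+Φ)² + C + 1`, `t ≥ 0`. [folklore] -/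
theorem fte_const_le {Φ D t : ℝ} (hΦ : 0 ≤ Φ) (hD : 0 ≤ D) (ht : 0 ≤ t) :
    18 * (1 + Φ) ^ 2 * Real.exp (192 * (1 + Φ) * D * t) ≤
      (18 * (1 + Φ) ^ 2 + 192 * (1 + Φ) * D + 1) *
        Real.exp ((18 * (1 + Φ) ^ 2 + 192 * (1 + Φ) * D + 1) * t) := by
  have hC0 : 0 ≤ 192 * (1 + Φ) * D := by positivity
  have h18 : 0 ≤ 18 * (1 + Φ) ^ 2 := by positivity
  have hK1 : 18 * (1 + Φ) ^ 2 ≤ 18 * (1 + Φ) ^ 2 + 192 * (1 + Φ) * D + 1 := by linarith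
  have hK2 : 192 * (1 + Φ) * D ≤ 18 * (1 + Φ) ^ 2 + 192 * (1 + Φ) * D + 1 := by linarith
  calc 18 * (1 + Φ) ^ 2 * Real.exp (192 * (1 + Φ) * D * t)
      ≤ (18 * (1 + Φ) ^ 2 + 192 * (1 + Φ) * D + 1) * Real.exp (192 * (1 + Φ) * D * t) :=
        mul_le_mul_of_nonneg_right hK1 (Real.exp_pos _).le
    _ ≤ (18 * (1 + Φ) ^ 2 + 192 * (1 + Φ) * D + 1) *
          Real.exp ((18 * (1 + Φ) ^ 2 + 192 * (1 + Φ) * D + 1) * t) :=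
        mul_le_mul_of_nonneg_left (Real.exp_le_exp.mpr (mul_le_mul_of_nonneg_right hK2 ht))
          (by linarith)

end Summit.FinalStateConjecture.FinalStateConjecture.Cruxes.AdiabaticMultiKerrILED.Sketch

end
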